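import Literature.AnabelianGeometry.AbsoluteAnabelian.AbsTopIProp23OuterFaithfulOfHomology
import Literature.AnabelianGeometry.AbsoluteAnabelian.AbsTopIDef21GFGQuotientExistence
import Literature.AnabelianGeometry.AbsoluteAnabelian.ProfiniteIndexTwoInversionModel
import HarnessLib

/-!
# [AbsTopI] Prop 2.3 (i) for ORBICURVE quotients of prime index: the homological input discharged

S. Mochizuki, *Topics in Absolute Anabelian Geometry I: Generalities* (2012) [AbsTopI] (lit key
`paper:url-11ac98ba15fc`), Def 2.1 (i) p. 17 (`X` a hyperbolic orbicurve, `Y → X` finite étale Galois with `Y`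
a curve, `Δ_X ⊇ Δ_Y^Σ`), Prop 2.3 (i) p. 19 ("`Δ` is slim and elastic"); [IUTchI] Def 3.1 (b)
(`C_F := X_F // {±1}`), Def 3.1 (d) (`C̲_K`, `X̲_K → C̲_K` of degree `2`).

abc-iut cell, seat abc-iut-f-051 (gen 4); PROOF-ONLY (no definition, no named fact).
`AbsTopIProp23OuterFaithfulOfHomology.lean` (p446316) proves Prop 2.3 (i) at the Def 2.1 (i) GFG construction
with an ARBITRARY discrete lattice `Γ` modulo the homological input (HOM) «every `γ ∈ Γ ∖ j⁻¹U` moves a class of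
`H₁(j⁻¹U, ℤ)`».  THIS FILE DISCHARGES (HOM) for the orbicurve lattices that occur in [IUTchI] — quotients
`X → C = [X/σ]` of PRIME order (`C_F = X_F/±1`, `C̲_K = X̲_K/±1`, hyperelliptic quotients) — from ONE
elementary witness, and at EVERY curve `Y → X → C` over them:

* `sup_zpowers_eq_top_of_index_prime`, `forall_exists_conj_not_mem_commutator_of_index_prime` — PRIME-INDEX
  CRITERION: `H ⊴ Γ` of prime index and `[Γ, Γ] ⊄ [H, H]` (one commutator of `Γ` outside `[H, H]`, or
  `rank H₁(Γ) < rank H₁(H)`: `not_commutator_le_of_finrank_lt`) ⇒ EVERY `γ ∉ H` moves a class of `H₁(H, ℤ)`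
  (p445378: otherwise `[Γ, Γ] = [H, H]`);
* `exists_conj_not_mem_commutator_of_pow_mem` — DESCENT: if `γ` moves a class of `H₁(H, ℤ)` (torsion-free)
  and `M ≤ H` has finite index with `h^N ∈ M`, then `γ` moves a class of `H₁(M, ℤ)`;
* `forall_exists_conj_not_mem_commutator_of_index_prime_of_le` — hence, for `H ≅ Γ_{g,r}` hyperbolic of prime
  index in `Γ` with `[Γ,Γ] ⊄ [H,H]`, (HOM) holds for EVERY finite-index `M ⊴ Γ` inside `H` (inside `H` it is
  the curve-case theorem `PuncturedSurfaceGroup.exists_conj_not_mem_commutator`, p445888);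
* `GFGSurfaceModel.slim_and_elastic_of_index_prime_lattice` — **(T1) `Z_D(π U) = 1`, (T3), (T4) `D` slim and
  elastic** at the Def 2.1 (i) construction for such `Γ` and EVERY open `U ⊴ P` with `j⁻¹U ≤ H` (every curve
  `Y → X → C`), OUTRIGHT;
* `exists_ellipticInvolutionLattice` — the lattice of `C = (E ∖ O)/±1` ([IUTchI] Def 3.1 (b)):
  `Γ = Γ_{1,1} ⋊ ⟨τ⟩`, `τ` the elliptic involution (`−1` on `H₁`; this lineage's p438586), has index-`2`
  `H = Γ_{1,1}`, torsion `τ ∉ H`, and the witness `[τ, a] ≡ a⁻² ∉ [H, H]`;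
  `exists_slim_and_elastic_gfgQuotient_ellipticInvolution` — so for `2 ∈ Σ′ ⊇ Σ ∋` a prime, the almost
  pro-`Σ`-maximal quotient `D = P/K_Σ(U)` of the pro-`Σ′` completion `P` of `Γ`, for ANY open `U ⊴ P` with
  `j⁻¹U ≤ Γ_{1,1}`, is slim and elastic with no nontrivial finite normal subgroup — **Prop 2.3 (i) for the
  ORBICURVE `C_F` at the GFG construction, outright** (such `U` exist: `exists_isOpen_normal_comap_eq`).

HONEST SCOPE: model-level; orbicurve quotients of PRIME order whose curve lattice is a `Γ_{g,r}`; general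
Fuchsian lattices keep the binder (HOM) (GAP-LEDGER G-f051g4-1).  Classical (pro)finite group theory; OUR kernel
check; nothing here bears on [IUTchIII] Cor. 3.12; no side is taken; typed ≠ proved elsewhere.
-/

noncomputable section

open Topology

universe u

namespace Literature.AnabelianGeometry.AbsoluteAnabelian

open Literature.AlgebraicGeometry.Frobenioids (IsSlimGroup)
open Literature.AnabelianGeometry.Anabelioids (IsSigmaInteger)
open Literature.AnabelianGeometry.SemiGraphs.SemiGraphOfAnabelioids
open Literature.AnabelianGeometry.SemiGraphs.SemiGraphOfAnabelioids.IsProSigmaCompletion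
open Literature.GroupTheory.CombinatorialGroupTheory

/-! ### The prime-index criterion -/

section Discrete

variable {Γ : Type*} [Group Γ]

/-- A subgroup of PRIME index together with any element outside it generates the whole group.
[cite: MochizukiAbsTopI2012, Prop 2.3 (i) p.19] -/
theorem sup_zpowers_eq_top_of_index_prime (H : Subgroup Γ) {p : ℕ} (hp : p.Prime) (hH : H.index = p)
    {γ : Γ} (hγ : γ ∉ H) : H ⊔ Subgroup.zpowers γ = ⊤ := by
  set L : Subgroup Γ := H ⊔ Subgroup.zpowers γ with hL
  have hHL : H ≤ L := le_sup_left
  have hγL : γ ∈ L := Subgroup.mem_sup_right (Subgroup.mem_zpowers γ)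
  have hmul : H.relIndex L * L.index = p := by rw [Subgroup.relIndex_mul_index hHL, hH]
  have hrel : H.relIndex L ≠ 1 := by
    rw [Ne, Subgroup.relIndex_eq_one]
    exact fun h => hγ (h hγL)
  rcases (Nat.dvd_prime hp).mp (Dvd.intro_left _ hmul) with h1 | hp'
  · exact Subgroup.index_eq_one.mp h1
  · exfalso
    rw [hp'] at hmul
    exact hrel ((Nat.mul_eq_right hp.ne_zero).mp hmul)

/-- A commutator of `Γ` outside `[H, H]` witnesses `[Γ, Γ] ⊄ [H, H]`. [cite: MochizukiAbsTopI2012, Prop 2.3 (i) p.19] -/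
theorem not_commutator_le_of_witness (H : Subgroup Γ) {x y : Γ} (hxy : x * y * x⁻¹ * y⁻¹ ∉ ⁅H, H⁆) :
    ¬ commutator Γ ≤ ⁅H, H⁆ := fun h =>
  hxy (h (by
    rw [commutator_def, ← commutatorElement_def]
    exact Subgroup.commutator_mem_commutator (Subgroup.mem_top x) (Subgroup.mem_top y)))

/-- `rank_ℤ H₁(Γ) < rank_ℤ H₁(H)` witnesses `[Γ, Γ] ⊄ [H, H]` (p445378 `finrank_abelianization_le_of_commutator_le`).
[cite: MochizukiAbsTopI2012, Prop 2.3 (i) p.19] -/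
theorem not_commutator_le_of_finrank_lt (H : Subgroup Γ) [Module.Finite ℤ (Additive (Abelianization Γ))]
    (hlt : Module.finrank ℤ (Additive (Abelianization Γ)) < Module.finrank ℤ (Additive (Abelianization H))) :
    ¬ commutator Γ ≤ ⁅H, H⁆ := fun h =>
  absurd hlt (not_lt.mpr (finrank_abelianization_le_of_commutator_le H h))

/-- **PRIME-INDEX CRITERION.**  If `H ⊴ Γ` has prime index and `[Γ, Γ] ⊄ [H, H]`, then EVERY `γ ∉ H` moves a
class of `H₁(H, ℤ)`: some `h ∈ H` has `γ h γ⁻¹ h⁻¹ ∉ [H, H]` (`Γ = H·⟨γ⟩`; if `γ` acted trivially then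
`[Γ, Γ] = [H, H]` by `commutator_le_commutator_of_sup_zpowers_eq_top`). [cite: MochizukiAbsTopI2012, Prop 2.3 (i) p.19] -/
theorem forall_exists_conj_not_mem_commutator_of_index_prime (H : Subgroup Γ) [H.Normal] {p : ℕ} (hp : p.Prime)
    (hH : H.index = p) (hw : ¬ commutator Γ ≤ ⁅H, H⁆) :
    ∀ γ : Γ, γ ∉ H → ∃ h ∈ H, γ * h * γ⁻¹ * h⁻¹ ∉ ⁅H, H⁆ := by
  intro γ hγ
  by_contra hall
  simp only [not_exists, not_and, not_not] at hall
  exact hw (commutator_le_commutator_of_sup_zpowers_eq_top H γ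
    (sup_zpowers_eq_top_of_index_prime H hp hH hγ) hall)

/-! ### Descent to finite-index subgroups -/

/-- A free abelian abelianisation is torsion-free: `x^N ∈ [H, H]`, `N ≥ 1` ⇒ `x ∈ [H, H]`.
[cite: MochizukiAbsTopI2012, Prop 2.3 (i) p.19] -/
theorem mem_commutator_of_pow_mem {H : Type*} [Group H] {n : ℕ}
    (L : Additive (Abelianization H) ≃ₗ[ℤ] (Fin n → ℤ)) (x : H) {N : ℕ} (hN : 0 < N)
    (hx : x ^ N ∈ commutator H) : x ∈ commutator H := by
  rw [← Abelianization.ker_of, MonoidHom.mem_ker] at hx ⊢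
  rw [map_pow] at hx
  have h1 : (N : ℤ) • L (Additive.ofMul (Abelianization.of x)) = 0 := by
    rw [← map_zsmul, ← ofMul_zpow, zpow_natCast, hx, ofMul_one, map_zero]
  have h2 : L (Additive.ofMul (Abelianization.of x)) = 0 := by
    rcases smul_eq_zero.mp h1 with h | h
    · exfalso; exact (Int.natCast_pos.mpr hN).ne' h
    · exact h
  have h3 : Additive.ofMul (Abelianization.of x) = 0 := by
    rw [← map_zero L] at h2
    exact L.injective h2
  exact h3

/-- **DESCENT.**  Let `M ≤ H ≤ Γ` with `γ` normalising `H`, `H₁(H, ℤ)` free abelian, and `h^N ∈ M` for all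
`h ∈ H` (`N ≥ 1`, e.g. `M ⊴ H` of index `N`).  If `γ` moves a class of `H₁(H, ℤ)` then `γ` moves a class of
`H₁(M, ℤ)`: for `γ h γ⁻¹ h⁻¹ ∉ [H, H]` the element `m := h^N` works, since `(γhγ⁻¹·h⁻¹)^N ≡ γh^Nγ⁻¹·h^{−N}` in
`H^{ab}` and `H^{ab}` has no `N`-torsion. [cite: MochizukiAbsTopI2012, Prop 2.3 (i) p.19] -/
theorem exists_conj_not_mem_commutator_of_pow_mem {M H : Subgroup Γ} (hMH : M ≤ H) {n : ℕ}
    (L : Additive (Abelianization H) ≃ₗ[ℤ] (Fin n → ℤ)) {N : ℕ} (hN : 0 < N) (hpow : ∀ h ∈ H, h ^ N ∈ M)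
    {γ : Γ} (hγH : γ ∈ Subgroup.normalizer (H : Set Γ))
    (hw : ∃ h ∈ H, γ * h * γ⁻¹ * h⁻¹ ∉ ⁅H, H⁆) :
    ∃ m ∈ M, γ * m * γ⁻¹ * m⁻¹ ∉ ⁅M, M⁆ := by
  obtain ⟨h, hh, hwit⟩ := hw
  refine ⟨h ^ N, hpow h hh, fun hmem => hwit ?_⟩
  have hγh : γ * h * γ⁻¹ ∈ H := (Subgroup.mem_normalizer_iff.mp hγH h).mp hh
  have hmem' : γ * h ^ N * γ⁻¹ * (h ^ N)⁻¹ ∈ (⁅H, H⁆ : Subgroup Γ) := Subgroup.commutator_mono hMH hMH hmem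
  -- in `H`: `(a b⁻¹)^N ∈ [H, H]` for `a = γhγ⁻¹`, `b = h`
  set a : H := ⟨γ * h * γ⁻¹, hγh⟩ with ha
  set b : H := ⟨h, hh⟩ with hb
  have hab : (a * b⁻¹ : H) ∈ commutator H := by
    refine mem_commutator_of_pow_mem L (a * b⁻¹) hN ?_
    -- `(a b⁻¹)^N ≡ a^N (b^N)⁻¹` in `H^{ab}`, and the latter lies in `[H, H]`
    have hmemH : (a ^ N * (b ^ N)⁻¹ : H) ∈ commutator H := by
      rw [mem_commutator_iff_coe_mem]
      have : ((a ^ N * (b ^ N)⁻¹ : H) : Γ) = γ * h ^ N * γ⁻¹ * (h ^ N)⁻¹ := by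
        simp only [ha, hb, Subgroup.coe_mul, Subgroup.coe_inv, Subgroup.coe_pow, conj_pow]
      rw [this]
      exact hmem'
    rw [← Abelianization.ker_of, MonoidHom.mem_ker] at hmemH ⊢
    rw [map_pow, map_mul, map_inv, mul_pow, inv_pow, ← map_pow, ← map_pow, ← map_inv, ← map_mul]
    exact hmemH
  rw [mem_commutator_iff_coe_mem] at hab
  simpa [ha, hb] using hab

/-- **(HOM) at every curve over a prime-order orbicurve quotient.**  Let `H ⊴ Γ` have prime index with
`[Γ, Γ] ⊄ [H, H]` and `H ≅ Γ_{g,r}` hyperbolic, and let `M ⊴ Γ` be of finite index with `M ≤ H`.  Then every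
`γ ∈ Γ ∖ M` moves a class of `H₁(M, ℤ)` (inside `H`: the curve case p445888; outside `H`: the prime-index
criterion, then descent). [cite: MochizukiAbsTopI2012, Prop 2.3 (i) p.19] -/
theorem forall_exists_conj_not_mem_commutator_of_index_prime_of_le (H : Subgroup Γ) [hHn : H.Normal]
    {p : ℕ} (hp : p.Prime) (hH : H.index = p) (hw : ¬ commutator Γ ≤ ⁅H, H⁆) {g r : ℕ}
    (hgr : PuncturedSurfaceGroup.IsHyperbolicType g r) (eH : H ≃* PuncturedSurfaceGroup g r)
    (M : Subgroup Γ) [hMn : M.Normal] [M.FiniteIndex] (hMH : M ≤ H) :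
    ∀ γ : Γ, γ ∉ M → ∃ m ∈ M, γ * m * γ⁻¹ * m⁻¹ ∉ ⁅M, M⁆ := by
  classical
  intro γ hγM
  -- `M` seen inside `H ≅ Γ_{g,r}`
  haveI hMHn : (M.subgroupOf H).Normal := hMn.subgroupOf H
  have hidx : (M.subgroupOf H).index * H.index = M.index := Subgroup.relIndex_mul_index hMH
  haveI hMHfi : (M.subgroupOf H).FiniteIndex := ⟨fun h0 => by
    rw [h0, zero_mul] at hidx
    exact Subgroup.FiniteIndex.index_ne_zero hidx.symm⟩
  by_cases hγH : γ ∈ H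
  · -- the curve case inside `H`, transported along `eH`
    set M' : Subgroup (PuncturedSurfaceGroup g r) := (M.subgroupOf H).map eH.toMonoidHom with hM'
    haveI : M'.FiniteIndex := ⟨by
      rw [hM', show eH.toMonoidHom = ((eH : H ≃* _) : H →* _) from rfl, Subgroup.index_map_equiv]
      exact hMHfi.index_ne_zero⟩
    haveI hM'n : M'.Normal := hMHn.map eH.toMonoidHom eH.surjective
    set γ' : PuncturedSurfaceGroup g r := eH ⟨γ, hγH⟩ with hγ'
    have hγ'M : γ' ∉ M' := by
      intro hmem
      obtain ⟨x, hx, hxe⟩ := Subgroup.mem_map.mp hmem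
      have : x = ⟨γ, hγH⟩ := eH.injective hxe
      rw [this, Subgroup.mem_subgroupOf] at hx
      exact hγM hx
    have hγ'N : γ' ∈ Subgroup.normalizer (M' : Set (PuncturedSurfaceGroup g r)) := by
      rw [Subgroup.normalizer_eq_top]; exact Subgroup.mem_top _
    obtain ⟨h', hh', hwit⟩ := PuncturedSurfaceGroup.exists_conj_not_mem_commutator hgr M' γ' hγ'N hγ'M
    obtain ⟨x, hx, rfl⟩ := Subgroup.mem_map.mp hh'
    rw [Subgroup.mem_subgroupOf] at hx
    refine ⟨x, hx, fun hmem => hwit ?_⟩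
    have hmemH : (⟨γ, hγH⟩ * x * ⟨γ, hγH⟩⁻¹ * x⁻¹ : H) ∈ ⁅M.subgroupOf H, M.subgroupOf H⁆ := by
      rw [mem_commutator_subgroupOf_iff hMH]
      exact hmem
    have := Subgroup.mem_map_of_mem eH.toMonoidHom hmemH
    rw [Subgroup.map_commutator] at this
    simpa [hγ', hM', MulEquiv.toMonoidHom_eq_coe] using this
  · -- outside `H`: prime-index criterion at `H`, then descent to `M`
    haveI : (⊤ : Subgroup (PuncturedSurfaceGroup g r)).FiniteIndex := ⟨by rw [Subgroup.index_top]; exact one_ne_zero⟩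
    obtain ⟨n, ⟨L⟩⟩ := PuncturedSurfaceGroup.exists_linearEquiv_abelianization_of_finiteIndex hgr ⊤
    let L' : Additive (Abelianization H) ≃ₗ[ℤ] (Fin n → ℤ) :=
      (MulEquiv.toAdditive (eH.trans Subgroup.topEquiv.symm).abelianizationCongr).toIntLinearEquiv.trans L
    refine exists_conj_not_mem_commutator_of_pow_mem hMH L' (Nat.pos_of_ne_zero hMHfi.index_ne_zero)
      (fun h hh => ?_) (by rw [Subgroup.normalizer_eq_top]; exact Subgroup.mem_top γ)
      (forall_exists_conj_not_mem_commutator_of_index_prime H hp hH hw γ hγH)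
    have := Subgroup.pow_index_mem (M.subgroupOf H) ⟨h, hh⟩
    rw [Subgroup.mem_subgroupOf] at this
    simpa using this

end Discrete

/-! ### The GFG construction over a prime-order orbicurve quotient: (T1)/(T3)/(T4) outright -/

namespace GFGSurfaceModel

open Literature.AnabelianGeometry.SemiGraphs.PSCDatum (IsMaxProSigmaQuotient)
open Literature.GroupTheory.ProfiniteSubquotients

variable {Sigma Sigma' : Set ℕ} {Γ : Type*} [Group Γ]
  {P : Type u} [Group P] [TopologicalSpace P] [IsTopologicalGroup P] [CompactSpace P]
  [TotallyDisconnectedSpace P]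
  {D : Type u} [Group D] [TopologicalSpace D] [IsTopologicalGroup D] [CompactSpace D] [T2Space D]
  [TotallyDisconnectedSpace D]
  {j : Γ →* P} {π : P →* D} {U : Subgroup P}

/-- **[AbsTopI] Prop 2.3 (i) at the Def 2.1 (i) construction over a PRIME-ORDER ORBICURVE QUOTIENT, outright.**
`j : Γ → P` a pro-`Σ′` completion of a lattice `Γ` with `H ⊴ Γ` of prime index, `H ≅ Γ_{g,r}` hyperbolic,
`[Γ, Γ] ⊄ [H, H]`; `U ⊴ P` open with `j⁻¹U ≤ H` (a curve `Y → X → C`); `π : P ↠ D` continuous, `ker π ≤ U`,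
presenting the maximal pro-`Σ` quotient on `U` (`Σ ⊆ Σ′` nonempty sets of primes).  Then `Z_D(π U) = 1`, `D` has
no nontrivial finite normal subgroup, and `D` is slim and elastic. [cite: MochizukiAbsTopI2012, Prop 2.3 (i) p.19] -/
theorem slim_and_elastic_of_index_prime_lattice (hSS : Sigma ⊆ Sigma') (hS : Sigma.Nonempty)
    (hSp : ∀ q ∈ Sigma, q.Prime) (hj : IsProSigmaCompletion Sigma' j) (H : Subgroup Γ) [H.Normal] {p : ℕ}
    (hp : p.Prime) (hH : H.index = p) (hw : ¬ commutator Γ ≤ ⁅H, H⁆) {g r : ℕ}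
    (hgr : PuncturedSurfaceGroup.IsHyperbolicType g r) (eH : H ≃* PuncturedSurfaceGroup g r)
    [hUn : U.Normal] (hUo : IsOpen (U : Set P)) (hUH : U.comap j ≤ H) (hπc : Continuous π)
    (hπs : Function.Surjective π) (hker : π.ker ≤ U) (hmax : IsMaxProSigmaQuotient Sigma (π.subgroupMap U)) :
    Subgroup.centralizer ((U.map π : Subgroup D) : Set D) = ⊥ ∧
      (∀ N : Subgroup D, N.Normal → (N : Set D).Finite → N = ⊥) ∧ IsSlimGroup D ∧ IsElastic D := by
  classical
  haveI : (U.comap j).FiniteIndex := finiteIndex_comap hj U hUo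
  haveI hMn : (U.comap j).Normal := hUn.comap j
  -- `j⁻¹U`, a finite-index subgroup of `H ≅ Γ_{g,r}`, is `≅ Γ_{g',r'}` hyperbolic
  set M' : Subgroup (PuncturedSurfaceGroup g r) := ((U.comap j).subgroupOf H).map eH.toMonoidHom with hM'
  have hidx : ((U.comap j).subgroupOf H).index * H.index = (U.comap j).index :=
    Subgroup.relIndex_mul_index hUH
  haveI hfi : ((U.comap j).subgroupOf H).FiniteIndex := ⟨fun h0 => by
    rw [h0, zero_mul] at hidx
    exact Subgroup.FiniteIndex.index_ne_zero hidx.symm⟩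
  haveI : M'.FiniteIndex := ⟨by
    rw [hM', show eH.toMonoidHom = ((eH : H ≃* _) : H →* _) from rfl, Subgroup.index_map_equiv]
    exact hfi.index_ne_zero⟩
  obtain ⟨g', r', θ, -, -, hgr', hθ, hrange, -⟩ :=
    puncturedSurfaceGroupFiniteIndexSubgroup_holds g r hgr M' inferInstance
  let e : U.comap j ≃* PuncturedSurfaceGroup g' r' :=
    (((Subgroup.subgroupOfEquivOfLe hUH).symm.trans (eH.subgroupMap ((U.comap j).subgroupOf H))).trans
      (MulEquiv.subgroupCongr hrange.symm)).trans (MonoidHom.ofInjective hθ).symm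
  have hHom := forall_exists_conj_not_mem_commutator_of_index_prime_of_le H hp hH hw hgr eH (U.comap j) hUH
  exact ⟨centralizer_map_eq_bot_of_homological hSS hS hSp hj hUo hgr' e hπc hπs hker hmax hHom,
    forall_finite_normal_eq_bot_of_homological hSS hS hSp hj hUo hgr' e hπc hπs hker hmax hHom,
    slim_and_elastic_of_homological hSS hS hSp hj hUo hgr' e hπc hπs hker hmax hHom⟩

end GFGSurfaceModel

/-! ### The lattice of `C = (E ∖ O)/±1`: `Γ_{1,1} ⋊ ⟨τ⟩` -/

/-- **The elliptic-involution lattice** `Γ = Γ_{1,1} ⋊ ⟨τ⟩` (`τ` the elliptic involution, `−1` on `H₁`;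
`π₁^{orb}((E ∖ O)/±1)`): its subgroup `H = Γ_{1,1}` is normal of index `2`, `Γ ∖ H` contains the involution `τ`
(torsion: an ORBICURVE lattice), and `[Γ, Γ] ⊄ [H, H]` — witness `[τ, a] = τ(a)·a⁻¹ ≡ a⁻²` for a primitive `a`.
[cite: MochizukiAbsTopI2012, Prop 2.3 (i) p.19] -/
theorem exists_ellipticInvolutionLattice :
    ∃ (Γ : Type) (_ : Group Γ) (H : Subgroup Γ) (_ : H.Normal) (t : Γ),
      H.index = 2 ∧ t ∉ H ∧ t * t = 1 ∧ t ≠ 1 ∧ Nonempty (H ≃* PuncturedSurfaceGroup 1 1) ∧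
        ¬ commutator Γ ≤ ⁅H, H⁆ := by
  classical
  obtain ⟨τ, hτ2, hτne, hτinv⟩ := PuncturedSurfaceGroup.exists_mulAut_inversion_one_one
  let Z : Subgroup (MulAut (PuncturedSurfaceGroup 1 1)) := Subgroup.zpowers τ
  have hZ : Nat.card Z = 2 := by
    rw [Nat.card_zpowers]
    exact orderOf_eq_prime (by rw [pow_two]; exact hτ2) hτne
  let t : Z := ⟨τ, Subgroup.mem_zpowers τ⟩
  let Γ := PuncturedSurfaceGroup 1 1 ⋊[Z.subtype] Z
  let H : Subgroup Γ := (SemidirectProduct.inl : PuncturedSurfaceGroup 1 1 →* Γ).range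
  haveI hHn : H.Normal := by
    change (SemidirectProduct.inl : PuncturedSurfaceGroup 1 1 →* Γ).range.Normal
    rw [SemidirectProduct.range_inl_eq_ker_rightHom]
    infer_instance
  have hHi : H.index = 2 := by
    change (SemidirectProduct.inl : PuncturedSurfaceGroup 1 1 →* Γ).range.index = 2
    rw [SemidirectProduct.range_inl_eq_ker_rightHom, Subgroup.index_ker,
      MonoidHom.range_eq_top.mpr SemidirectProduct.rightHom_surjective, Subgroup.card_top, hZ]
  have htH : (SemidirectProduct.inr t : Γ) ∉ H := by
    intro h
    change SemidirectProduct.inr t ∈ (SemidirectProduct.inl : PuncturedSurfaceGroup 1 1 →* Γ).range at h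
    rw [SemidirectProduct.range_inl_eq_ker_rightHom, MonoidHom.mem_ker, SemidirectProduct.rightHom_inr] at h
    exact hτne (congrArg Subtype.val h)
  have htt : (SemidirectProduct.inr t : Γ) * SemidirectProduct.inr t = 1 := by
    rw [← map_mul, ← map_one (SemidirectProduct.inr : Z →* Γ)]
    congr 1
    exact Subtype.ext hτ2
  have ht1 : (SemidirectProduct.inr t : Γ) ≠ 1 := fun h => htH (h ▸ H.one_mem)
  -- a primitive element `a` with `a² ∉ [Γ_{1,1}, Γ_{1,1}]` (character to `ℤ/4` with value `1`)
  have hgr : PuncturedSurfaceGroup.IsHyperbolicType 1 1 := by unfold PuncturedSurfaceGroup.IsHyperbolicType; omega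
  obtain ⟨f, a, hfa⟩ := PuncturedSurfaceGroup.exists_monoidHom_zmod_apply_eq_ofAdd_one hgr 4
  have ha2 : a⁻¹ * a⁻¹ ∉ commutator (PuncturedSurfaceGroup 1 1) := by
    intro hmem
    have h1 : f (a⁻¹ * a⁻¹) = 1 := Abelianization.commutator_subset_ker f hmem
    rw [map_mul, map_inv, hfa, ← ofAdd_neg, ← ofAdd_add, ← ofAdd_zero] at h1
    exact absurd (Multiplicative.ofAdd.injective h1) (by decide)
  have hw : τ a * a⁻¹ ∉ commutator (PuncturedSurfaceGroup 1 1) := by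
    intro hmem
    apply ha2
    have : a⁻¹ * a⁻¹ = (τ a * a)⁻¹ * (τ a * a⁻¹) := by group
    rw [this]
    exact Subgroup.mul_mem _ (Subgroup.inv_mem _ (hτinv a)) hmem
  refine ⟨Γ, inferInstance, H, hHn, SemidirectProduct.inr t, hHi, htH, htt, ht1,
    ⟨(MonoidHom.ofInjective SemidirectProduct.inl_injective).symm⟩,
    not_commutator_le_of_witness H (x := SemidirectProduct.inr t) (y := SemidirectProduct.inl a) ?_⟩
  -- `[t, inl a] = inl (τ a · a⁻¹) ∉ [H, H] = inl [Γ_{1,1}, Γ_{1,1}]`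
  have h1 : (SemidirectProduct.inr t : Γ) * SemidirectProduct.inl a * (SemidirectProduct.inr t)⁻¹ =
      SemidirectProduct.inl (τ a) := by
    rw [← map_inv, ← SemidirectProduct.inl_aut]
    rfl
  have hconj : (SemidirectProduct.inr t : Γ) * SemidirectProduct.inl a * (SemidirectProduct.inr t)⁻¹ *
      (SemidirectProduct.inl a)⁻¹ = SemidirectProduct.inl (τ a * a⁻¹) := by
    rw [h1, ← map_inv, ← map_mul]
  rw [hconj]
  change SemidirectProduct.inl (τ a * a⁻¹) ∉
    ⁅(SemidirectProduct.inl : PuncturedSurfaceGroup 1 1 →* Γ).range,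
      (SemidirectProduct.inl : PuncturedSurfaceGroup 1 1 →* Γ).range⁆
  rw [MonoidHom.range_eq_map, ← Subgroup.map_commutator, ← commutator_def]
  intro hmem
  obtain ⟨x, hx, hxe⟩ := Subgroup.mem_map.mp hmem
  exact hw (SemidirectProduct.inl_injective hxe ▸ hx)

/-! ### Prop 2.3 (i) for `C_F = (E ∖ O)/±1` at the GFG construction, outright -/

/-- For a pro-`Σ′` completion `j : Γ → P` with `2 ∈ Σ′` and `H ⊴ Γ` of index `2`, there is an open normal
`U ⊴ P` with `j⁻¹U = H` (so the admissible `U` of the next theorem exist). [cite: MochizukiAbsTopI2012, Def 2.1 (i) p.17] -/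
theorem exists_isOpen_normal_comap_eq {Γ : Type*} [Group Γ] {P : Type u} [Group P] [TopologicalSpace P]
    [IsTopologicalGroup P] [CompactSpace P] [TotallyDisconnectedSpace P] {Sigma' : Set ℕ} {j : Γ →* P}
    (hj : IsProSigmaCompletion Sigma' j) (h2 : 2 ∈ Sigma') (H : Subgroup Γ) [hHn : H.Normal] (hH : H.index = 2) :
    ∃ U : Subgroup P, U.Normal ∧ IsOpen (U : Set P) ∧ U.comap j = H := by
  have hint : IsSigmaInteger Sigma' H.index := by
    rw [hH]
    exact ⟨two_pos, fun q hq hq2 => by rwa [(Nat.prime_dvd_prime_iff_eq hq Nat.prime_two).mp hq2]⟩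
  obtain ⟨U, hUo, hUc⟩ := hj.comap_surj H hHn hint
  exact ⟨U, normal_of_comap_normal hj U hUo (by rw [hUc]; exact hHn), hUo, hUc⟩

/-- **[AbsTopI] Prop 2.3 (i) for the orbicurve `C = (E ∖ O)/±1` ([IUTchI] Def 3.1 (b): `C_F = X_F // {±1}`) at
the Def 2.1 (i) GFG construction, OUTRIGHT.**  For the elliptic-involution lattice `Γ ⊇ H = Γ_{1,1}` of
`exists_ellipticInvolutionLattice`, nonempty sets of primes `Σ ⊆ Σ′`, ANY pro-`Σ′` completion `j : Γ → P`
(`P` profinite) and ANY open `U ⊴ P` with `j⁻¹U ≤ H` (a curve `Y → X_F → C_F`): the almost pro-`Σ`-maximal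
quotient `D = P/K` of Def 2.1 (i) (`K = K_Σ(U)`, abc-iut-w6-d030's `exists_gfgQuotient`) is slim and elastic and
has no nontrivial finite normal subgroup. [cite: MochizukiAbsTopI2012, Prop 2.3 (i) p.19] -/
theorem exists_slim_and_elastic_gfgQuotient_of_index_prime_lattice {Γ : Type*} [Group Γ]
    (H : Subgroup Γ) [H.Normal] {p : ℕ} (hp : p.Prime) (hH : H.index = p) (hw : ¬ commutator Γ ≤ ⁅H, H⁆)
    {g r : ℕ} (hgr : PuncturedSurfaceGroup.IsHyperbolicType g r) (eH : H ≃* PuncturedSurfaceGroup g r)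
    {Sigma Sigma' : Set ℕ} (hSS : Sigma ⊆ Sigma') (hS : Sigma.Nonempty) (hSp : ∀ q ∈ Sigma, q.Prime)
    {P : Type u} [Group P] [TopologicalSpace P] [IsTopologicalGroup P] [CompactSpace P] [T2Space P]
    [TotallyDisconnectedSpace P] {j : Γ →* P} (hj : IsProSigmaCompletion Sigma' j)
    (U : Subgroup P) [U.Normal] (hUo : IsOpen (U : Set P)) (hUH : U.comap j ≤ H) :
    ∃ (K : Subgroup P) (_ : K.Normal) (_ : IsClosed (K : Set P)), K ≤ U ∧
      Literature.AnabelianGeometry.SemiGraphs.PSCDatum.IsMaxProSigmaQuotient Sigma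
        ((QuotientGroup.mk' K).subgroupMap U) ∧
      IsSlimGroup (P ⧸ K) ∧ IsElastic (P ⧸ K) ∧
      ∀ N : Subgroup (P ⧸ K), N.Normal → (N : Set (P ⧸ K)).Finite → N = ⊥ := by
  obtain ⟨K, hKn, hKc, hKU, hmax⟩ := GFGSurfaceModel.exists_gfgQuotient Sigma U hUo
  haveI := hKn
  haveI : IsClosed ((K : Subgroup P) : Set P) := hKc
  haveI : TotallyDisconnectedSpace (P ⧸ K) :=
    Literature.GroupTheory.ProfiniteSubquotients.totallyDisconnectedSpace_quotient K hKc
  have hker : (QuotientGroup.mk' K).ker ≤ U := by rw [QuotientGroup.ker_mk']; exact hKU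
  obtain ⟨-, hFN, hs, he⟩ := GFGSurfaceModel.slim_and_elastic_of_index_prime_lattice hSS hS hSp hj H hp hH hw
    hgr eH hUo hUH QuotientGroup.continuous_mk (QuotientGroup.mk'_surjective K) hker hmax
  exact ⟨K, hKn, hKc, hKU, hmax, hs, he, hFN⟩

end Literature.AnabelianGeometry.AbsoluteAnabelian

end
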